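import Summits.CriticalPhenomena.PercolationContinuityZ3.Theorems.Transplant.FKConnectivityAllQAntipodalX2WordsSigmaBlocks
import HarnessLib

/-!
# Connectivity correlation inequalities for `φ_{w,q}` — σ-WORDS, file 13: the rows of an inert-free σ-word are the rows of its
# type word up to multiplicities; loser test and run count agree (`sIsLoser_eq`, `sIsWinner_eq`, `sRuns_eq`)

Helper file (`--supports stmt-CriticalPhenomena-4575`), FK sub-lane `prim-bschramm-fk-2` (gen 13); builds on p205010 (kernel
theorem, internal audit signed; external expert review pending).  Pure finite combinatorics (memo `bschramm/FROM-fk-2-g13-WORD-HALL.md`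
§1.3 and §7.2: the LIFT of Theorem A from type words to gen 12's σ-words).
[cite: Grimmett2006, §3.9 (p. 63)]
-/

namespace Summit.CriticalPhenomena.PercolationContinuityZ3.Theorems

namespace FK

namespace X2Word

/-! ### Rows of an inert-free word versus rows of its type word -/

section RowsVsType

/-- For a non-inert letter of kind `W`: invisible to `A` iff it is `ω = 10`; of kind `P`: iff it is `λ = 01`. Dually for `B`. [folklore] -/
theorem sVisA_false_iff (l : SLetter) (hl : isInert l = false) :
    sVisA l = false ↔ (l.1 = .W ∧ l.2 = (true, false)) ∨ (l.1 = .P ∧ l.2 = (false, true)) := by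
  obtain ⟨k, b, bb⟩ := l
  cases k <;> cases b <;> cases bb <;> simp [sVisA, sVisB, isInert] at hl ⊢

/-- Row `B` analogue of `sVisA_false_iff`. [folklore] -/
theorem sVisB_false_iff (l : SLetter) (hl : isInert l = false) :
    sVisB l = false ↔ (l.1 = .W ∧ l.2 = (false, true)) ∨ (l.1 = .P ∧ l.2 = (true, false)) := by
  obtain ⟨k, b, bb⟩ := l
  cases k <;> cases b <;> cases bb <;> simp [sVisA, sVisB, isInert] at hl ⊢

/-- `kindAt` from the other kind. [folklore] -/
theorem kindAt_other (k : Kind) (j : ℕ) : kindAt k.other j = (kindAt k j).other := by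
  induction j with
  | zero => rfl
  | succ j ih => rw [kindAt_succ, kindAt_succ, ih]

/-- Emptiness of a filter as an `all`. [folklore] -/
theorem filter_eq_nil_iff_all {α : Type*} (p : α → Bool) (l : List α) : l.filter p = [] ↔ ∀ a ∈ l, p a = false := by
  rw [List.filter_eq_nil_iff]; simp

/-- The two "all" tests of `tyOf` exclude each other on a nonempty block. [folklore] -/
theorem not_allLam_of_allOm {ls : List SLetter} (hne : ls ≠ []) (h : ∀ l ∈ ls, l.2 = (true, false)) :
    ¬ (∀ l ∈ ls, l.2 = (false, true)) := by
  obtain ⟨l₀, hl₀⟩ := List.exists_mem_of_ne_nil ls hne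
  intro h'
  have a := h l₀ hl₀; have b := h' l₀ hl₀
  rw [a] at b; simp at b

/-- `tyOf` in terms of the two "all" predicates. [folklore] -/
theorem tyOf_eq (ls : List SLetter) :
    tyOf ls = if (∀ l ∈ ls, l.2 = (false, true)) then .E else if (∀ l ∈ ls, l.2 = (true, false)) then .F else .M := by
  unfold tyOf
  simp only [List.all_eq_true, decide_eq_true_eq]

/-- Visibility of a block at the type level is visibility of some letter (row `A`). [folklore] -/
theorem visA_tyOf (k : Kind) (ls : List SLetter) (hne : ls ≠ []) (hk : ∀ l ∈ ls, l.1 = k) (hni : ∀ l ∈ ls, isInert l = false) :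
    visA k (tyOf ls) = !decide (ls.filter sVisA = []) := by
  rw [tyOf_eq]
  have hfilt : ls.filter sVisA = [] ↔ ∀ l ∈ ls, (l.1 = .W ∧ l.2 = (true, false)) ∨ (l.1 = .P ∧ l.2 = (false, true)) := by
    rw [filter_eq_nil_iff_all]
    exact ⟨fun h l hl => (sVisA_false_iff l (hni l hl)).mp (h l hl), fun h l hl => (sVisA_false_iff l (hni l hl)).mpr (h l hl)⟩
  cases k with
  | W =>
    have hf : ls.filter sVisA = [] ↔ ∀ l ∈ ls, l.2 = (true, false) := by
      rw [hfilt]; constructor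
      · intro h l hl; rcases h l hl with ⟨-, h2⟩ | ⟨h1, -⟩; exact h2; exact absurd (hk l hl) (by rw [h1]; decide)
      · intro h l hl; exact Or.inl ⟨hk l hl, h l hl⟩
    by_cases hO : ∀ l ∈ ls, l.2 = (true, false)
    · have hL := not_allLam_of_allOm hne hO
      rw [if_neg hL, if_pos hO]; simp [hf.mpr hO, visA]
    · have hf' : ¬ ls.filter sVisA = [] := fun h => hO (hf.mp h)
      by_cases hL : ∀ l ∈ ls, l.2 = (false, true)
      · rw [if_pos hL]; simp [hf', visA]
      · rw [if_neg hL, if_neg hO]; simp [hf', visA]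
  | P =>
    have hf : ls.filter sVisA = [] ↔ ∀ l ∈ ls, l.2 = (false, true) := by
      rw [hfilt]; constructor
      · intro h l hl; rcases h l hl with ⟨h1, -⟩ | ⟨-, h2⟩; exact absurd (hk l hl) (by rw [h1]; decide); exact h2
      · intro h l hl; exact Or.inr ⟨hk l hl, h l hl⟩
    by_cases hL : ∀ l ∈ ls, l.2 = (false, true)
    · rw [if_pos hL]; simp [hf.mpr hL, visA]
    · have hf' : ¬ ls.filter sVisA = [] := fun h => hL (hf.mp h)
      by_cases hO : ∀ l ∈ ls, l.2 = (true, false)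
      · rw [if_neg hL, if_pos hO]; simp [hf', visA]
      · rw [if_neg hL, if_neg hO]; simp [hf', visA]

/-- Row `B` analogue. [folklore] -/
theorem visB_tyOf (k : Kind) (ls : List SLetter) (hne : ls ≠ []) (hk : ∀ l ∈ ls, l.1 = k) (hni : ∀ l ∈ ls, isInert l = false) :
    visB k (tyOf ls) = !decide (ls.filter sVisB = []) := by
  rw [tyOf_eq]
  have hfilt : ls.filter sVisB = [] ↔ ∀ l ∈ ls, (l.1 = .W ∧ l.2 = (false, true)) ∨ (l.1 = .P ∧ l.2 = (true, false)) := by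
    rw [filter_eq_nil_iff_all]
    exact ⟨fun h l hl => (sVisB_false_iff l (hni l hl)).mp (h l hl), fun h l hl => (sVisB_false_iff l (hni l hl)).mpr (h l hl)⟩
  cases k with
  | W =>
    have hf : ls.filter sVisB = [] ↔ ∀ l ∈ ls, l.2 = (false, true) := by
      rw [hfilt]; constructor
      · intro h l hl; rcases h l hl with ⟨-, h2⟩ | ⟨h1, -⟩; exact h2; exact absurd (hk l hl) (by rw [h1]; decide)
      · intro h l hl; exact Or.inl ⟨hk l hl, h l hl⟩
    by_cases hL : ∀ l ∈ ls, l.2 = (false, true)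
    · rw [if_pos hL]; simp [hf.mpr hL, visB]
    · have hf' : ¬ ls.filter sVisB = [] := fun h => hL (hf.mp h)
      by_cases hO : ∀ l ∈ ls, l.2 = (true, false)
      · rw [if_neg hL, if_pos hO]; simp [hf', visB]
      · rw [if_neg hL, if_neg hO]; simp [hf', visB]
  | P =>
    have hf : ls.filter sVisB = [] ↔ ∀ l ∈ ls, l.2 = (true, false) := by
      rw [hfilt]; constructor
      · intro h l hl; rcases h l hl with ⟨h1, -⟩ | ⟨-, h2⟩; exact absurd (hk l hl) (by rw [h1]; decide); exact h2
      · intro h l hl; exact Or.inr ⟨hk l hl, h l hl⟩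
    by_cases hO : ∀ l ∈ ls, l.2 = (true, false)
    · have hL := not_allLam_of_allOm hne hO
      rw [if_neg hL, if_pos hO]; simp [hf.mpr hO, visB]
    · have hf' : ¬ ls.filter sVisB = [] := fun h => hO (hf.mp h)
      by_cases hL : ∀ l ∈ ls, l.2 = (false, true)
      · rw [if_pos hL]; simp [hf', visB]
      · rw [if_neg hL, if_neg hO]; simp [hf', visB]

/-- Row `A` of a one-kind block is a power of its kind. [folklore] -/
theorem sRowA_block (k : Kind) (ls : List SLetter) (hk : ∀ l ∈ ls, l.1 = k) :
    sRowA ls = List.replicate (ls.filter sVisA).length k := by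
  unfold sRowA
  rw [List.eq_replicate_iff]
  refine ⟨by simp, fun a ha => ?_⟩
  obtain ⟨l, hl, rfl⟩ := List.mem_map.mp ha
  exact hk l (List.mem_of_mem_filter hl)

/-- Row `B` of a one-kind block. [folklore] -/
theorem sRowB_block (k : Kind) (ls : List SLetter) (hk : ∀ l ∈ ls, l.1 = k) :
    sRowB ls = List.replicate (ls.filter sVisB).length k := by
  unfold sRowB
  rw [List.eq_replicate_iff]
  refine ⟨by simp, fun a ha => ?_⟩
  obtain ⟨l, hl, rfl⟩ := List.mem_map.mp ha
  exact hk l (List.mem_of_mem_filter hl)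

/-- Row `A` of a word is the `expand` of its block counts. [folklore] -/
theorem sRowA_eq_expand (v : List SLetter) :
    sRowA v = expand ((blocks v).map fun b => (b.1, (b.2.filter sVisA).length)) := by
  have hL := blocks_letters v
  conv_lhs => rw [← flatten_blocks v]
  generalize blocks v = L at hL ⊢
  induction L with
  | nil => rfl
  | cons b L ih =>
    rw [List.flatMap_cons, sRowA_append, ih (fun b' hb' => hL b' (List.mem_cons_of_mem _ hb')), List.map_cons]
    obtain ⟨k, ls⟩ := b
    rw [expand_cons, sRowA_block k ls (hL (k, ls) (by simp)).2]

/-- Row `B` of a word is the `expand` of its block counts. [folklore] -/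
theorem sRowB_eq_expand (v : List SLetter) :
    sRowB v = expand ((blocks v).map fun b => (b.1, (b.2.filter sVisB).length)) := by
  have hL := blocks_letters v
  conv_lhs => rw [← flatten_blocks v]
  generalize blocks v = L at hL ⊢
  induction L with
  | nil => rfl
  | cons b L ih =>
    rw [List.flatMap_cons, sRowB_append, ih (fun b' hb' => hL b' (List.mem_cons_of_mem _ hb')), List.map_cons]
    obtain ⟨k, ls⟩ := b
    rw [expand_cons, sRowB_block k ls (hL (k, ls) (by simp)).2]

/-- Row `A` of the type word is the `skel` of the block counts (inert-free word). [folklore] -/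
theorem rowA_typeword_eq_skel (v : List SLetter) (hv : ∀ l ∈ v, isInert l = false) :
    rowA (kind0 v) (typeword v) = skel ((blocks v).map fun b => (b.1, (b.2.filter sVisA).length)) := by
  have hL := blocks_letters v
  have hK := blocks_kind v
  have hni : ∀ b ∈ blocks v, ∀ l ∈ b.2, isInert l = false := by
    intro b hb l hl
    apply hv
    rw [← flatten_blocks v]
    exact List.mem_flatMap.mpr ⟨b, hb, hl⟩
  unfold typeword
  generalize kind0 v = k0 at hK
  generalize blocks v = L at hL hK hni
  induction L generalizing k0 with
  | nil => rfl
  | cons b L ih =>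
    obtain ⟨k, ls⟩ := b
    have hk0 : k = k0 := by have := hK 0 (by simp); rwa [List.getElem_cons_zero, kindAt_zero] at this
    subst hk0
    rw [List.map_cons, rowA_cons, List.map_cons, skel_cons]
    obtain ⟨hne, hkind⟩ := hL (k, ls) (by simp)
    rw [visA_tyOf k ls hne hkind (hni (k, ls) (by simp))]
    congr 1
    · cases List.filter sVisA ls <;> simp
    · apply ih
      · intro b hb; exact hL b (List.mem_cons_of_mem _ hb)
      · intro j hj
        have := hK (j + 1) (by simpa using hj)
        rw [List.getElem_cons_succ, kindAt_succ, ← kindAt_other] at this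
        exact this
      · intro b hb; exact hni b (List.mem_cons_of_mem _ hb)

/-- Row `B` of the type word is the `skel` of the block counts. [folklore] -/
theorem rowB_typeword_eq_skel (v : List SLetter) (hv : ∀ l ∈ v, isInert l = false) :
    rowB (kind0 v) (typeword v) = skel ((blocks v).map fun b => (b.1, (b.2.filter sVisB).length)) := by
  have hL := blocks_letters v
  have hK := blocks_kind v
  have hni : ∀ b ∈ blocks v, ∀ l ∈ b.2, isInert l = false := by
    intro b hb l hl
    apply hv
    rw [← flatten_blocks v]
    exact List.mem_flatMap.mpr ⟨b, hb, hl⟩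
  unfold typeword
  generalize kind0 v = k0 at hK
  generalize blocks v = L at hL hK hni
  induction L generalizing k0 with
  | nil => rfl
  | cons b L ih =>
    obtain ⟨k, ls⟩ := b
    have hk0 : k = k0 := by have := hK 0 (by simp); rwa [List.getElem_cons_zero, kindAt_zero] at this
    subst hk0
    rw [List.map_cons, rowB_cons, List.map_cons, skel_cons]
    obtain ⟨hne, hkind⟩ := hL (k, ls) (by simp)
    rw [visB_tyOf k ls hne hkind (hni (k, ls) (by simp))]
    congr 1
    · cases List.filter sVisB ls <;> simp
    · apply ih
      · intro b hb; exact hL b (List.mem_cons_of_mem _ hb)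
      · intro j hj
        have := hK (j + 1) (by simpa using hj)
        rw [List.getElem_cons_succ, kindAt_succ, ← kindAt_other] at this
        exact this
      · intro b hb; exact hni b (List.mem_cons_of_mem _ hb)

/-- **The σ-word's loser test and run count are those of its type word** (inert-free words). [folklore] -/
theorem sIsLoser_eq (v : List SLetter) (hv : ∀ l ∈ v, isInert l = false) : sIsLoser v = isLoser (kind0 v) (typeword v) := by
  unfold sIsLoser isLoser
  rw [sRowA_eq_expand, sRowB_eq_expand, rowA_typeword_eq_skel v hv, rowB_typeword_eq_skel v hv,
    headP_expand, headP_expand, lastP_expand, lastP_expand]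

/-- The winner test agrees with the type word's. [folklore] -/
theorem sIsWinner_eq (v : List SLetter) (hv : ∀ l ∈ v, isInert l = false) : sIsWinner v = isWinner (kind0 v) (typeword v) := by
  unfold sIsWinner isWinner
  rw [sRowA_eq_expand, sRowB_eq_expand, rowA_typeword_eq_skel v hv, rowB_typeword_eq_skel v hv,
    headP_expand, headP_expand, lastP_expand, lastP_expand]

/-- The run count agrees with the type word's level. [folklore] -/
theorem sRuns_eq (v : List SLetter) (hv : ∀ l ∈ v, isInert l = false) : sRuns v = level (kind0 v) (typeword v) := by
  unfold sRuns level runsP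
  rw [sRowA_eq_expand, sRowB_eq_expand, rowA_typeword_eq_skel v hv, rowB_typeword_eq_skel v hv,
    runsAux_expand, runsAux_expand]

end RowsVsType



end X2Word

end FK

end Summit.CriticalPhenomena.PercolationContinuityZ3.Theorems
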